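import Literature.NumberTheory.PAdicHodge.DeRhamEllipticGoodOrdinaryAbove
import Literature.NumberTheory.EllipticCurves.KellerYin2024.PotentiallyGoodOrdinaryPConverse
import Literature.NumberTheory.EllipticCurves.IwasawaSelmerOrdinaryProofs
import Literature.NumberTheory.EllipticCurves.BSDConductorProofs
import Literature.NumberTheory.EllipticCurves.DeuringOrdinaryReductionHoldsProofs
import HarnessLib

/-!
# hDR in the potentially-good-ORDINARY sector over `ℚ`: `V_pW|_{Γ_{K_w}}` is de Rham at every place `w ∣ p`
# of every number field, for `W/ℚ` with potentially good ordinary reduction at `p`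

Topic `NumberTheory/PAdicHodge`; theorems only (no definition, no named fact, no instance).

For `W/ℚ` elliptic and a prime `p` of POTENTIALLY GOOD ORDINARY reduction in the tree's sense
(`WeierstrassCurve.HasPotentiallyGoodOrdinaryReductionAtPrime`: some number field `F` and place `w ∣ p` at which
`W ×_ℚ F` has good reduction with the unit-root condition — Silverman VII.5 Definition + V.3; e.g. `p ≥ 5` of additive
Kodaira type IV*, III*, II* with ordinary semistable `j̃`):

* `isDeRham_restrictedRationalTateRep_adicCompletion_rat_of_potentiallyGoodOrdinary` — at the place `v = (p)` of `ℚ`,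
  `V_pW|_{Γ_{ℚ_v}}` is de Rham for `B_dR(ℚ_v)` (any `ℚ_p`-structure): the witness `(F, w)` lies over `v`
  (`natCast_mem_asIdeal_iff_eq_primesEquiv_symm`), the unit-root condition is `p ∤ a_w` (`hasUnitRootAt_iff`,
  `ringChar_residueField_eq`), and `isDeRham_restrictedRationalTateRep_of_goodOrdinary_above` applies;
* `isDeRham_restrictedRationalTateRep_adicCompletion_of_potentiallyGoodOrdinary` — at every place `w' ∣ p` of every
  number field `K'`: ascent along `ℚ_v → K'_{w'}` (`isDeRham_restrictedRationalTateRep_of_tower`, Brinon–Conrad 6.3.8).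

This is the instance `K₀ = ℚ`, `F = K'_{w'}` of the cite-only hDR `isDeRham_restrictedRationalTateRep` (BSD crux K★
`stmt-BirchSwinnertonDyer-22226`) for curves with potentially good ordinary reduction at `p` — in particular the K★
cells `(5, III*)`, `(7, IV*)`, `(7, II*)` once their potential ordinarity is recorded. The supersingular cells are not
covered. BSD is not proved by any of this; hDR stays cite-only.

## References

* [SilvermanAEC2009] J. H. Silverman, *AEC* (2009), VII.5 (potential good reduction), V.3 (ordinary).
* [Greenberg1991] R. Greenberg, *Iwasawa theory for p-adic representations*, §2.
* [BrinonConrad2009] O. Brinon, B. Conrad (2009), Prop. 6.3.8.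
-/

noncomputable section

open Field ValuativeRel NumberField IsDedekindDomain

namespace Literature.NumberTheory.PAdicHodge

open Literature.NumberTheory.GaloisRepresentations
open Literature.NumberTheory.GaloisRepresentations.IsNonarchimedeanLocalField
open Literature.NumberTheory.EllipticCurves WeierstrassCurve
open Literature.NumberTheory.Automorphic

/-- **Potentially good ordinary at `p` ⇒ `V_pW|_{Γ_{ℚ_v}}` de Rham at the place `v = (p)` of `ℚ`.**
[cite: SilvermanAEC2009, VII.5 Definition (potential good reduction) and V.3] [cite: Greenberg1991, §2]
[cite: BrinonConrad2009, Prop. 6.3.8] -/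
theorem isDeRham_restrictedRationalTateRep_adicCompletion_rat_of_potentiallyGoodOrdinary
    (W : WeierstrassCurve ℚ) [W.IsElliptic] {p : ℕ} [Fact p.Prime]
    (h : W.HasPotentiallyGoodOrdinaryReductionAtPrime p)
    (v : HeightOneSpectrum (𝓞 ℚ)) (hv : (p : 𝓞 ℚ) ∈ v.asIdeal)
    [CharZero (v.adicCompletion ℚ)] [Fact (¬ IsUnit (p : integerC (v.adicCompletion ℚ)))]
    [IsAdicComplete (Ideal.span {(p : integerC (v.adicCompletion ℚ))}) (integerC (v.adicCompletion ℚ))]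
    (hp : valuation (v.adicCompletion ℚ) p < 1) [Algebra ℚ_[p] (v.adicCompletion ℚ)] :
    GaloisRep.IsDeRham (bdRPeriodRingData (F := v.adicCompletion ℚ) (p := p) hp)
      (restrictedRationalTateRep W (v.adicCompletion ℚ) p) := by
  obtain ⟨F, _, _, w, hpw, hgood, hunit⟩ := h
  have hpr : (p : ℕ).Prime := Fact.out
  -- `w` lies over `v`: both `v` and `w ∩ ℤ` are the place `(p)` of `ℚ`
  haveI : w.asIdeal.LiesOver (w.under (𝓞 ℚ)).asIdeal := liesOver_under w
  have hv₀ : (p : 𝓞 ℚ) ∈ (w.under (𝓞 ℚ)).asIdeal := (natCast_mem_asIdeal_iff_of_liesOver (w.under (𝓞 ℚ)) w p).1 hpw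
  have hvw : v = w.under (𝓞 ℚ) :=
    ((natCast_mem_asIdeal_iff_eq_primesEquiv_symm v hpr).1 hv).trans
      ((natCast_mem_asIdeal_iff_eq_primesEquiv_symm (w.under (𝓞 ℚ)) hpr).1 hv₀).symm
  subst hvw
  -- the unit-root condition is `p ∤ a_w`
  have hord : ¬ ((p : ℤ) ∣ (W.baseChange F).frobeniusTraceAt w) := by
    have h1 := (WeierstrassCurve.hasUnitRootAt_iff w (W.baseChange F)).1 hunit
    rw [WeierstrassCurve.ringChar_residueField_eq w hpr hpw] at h1
    exact h1
  have key := isDeRham_restrictedRationalTateRep_of_goodOrdinary_above W (w.under (𝓞 ℚ)) w hpw hgood hord hp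
  -- `Algebra ℚ ℚ_v` is a subsingleton: the statement's instance is the one of `key`
  rw [show (DivisionRing.toRatAlgebra : Algebra ℚ ((w.under (𝓞 ℚ)).adicCompletion ℚ)) =
      HeightOneSpectrum.instAlgebraAdicCompletion (𝓞 ℚ) ℚ (w.under (𝓞 ℚ)) from Subsingleton.elim _ _]
  exact key

/-- **Potentially good ordinary at `p` ⇒ `V_pW|_{Γ_{K'_{w'}}}` de Rham at every place `w' ∣ p` of every number
field `K'`** (ascent along `ℚ_v → K'_{w'}`). [cite: BrinonConrad2009, Prop. 6.3.8] [cite: Greenberg1991, §2] -/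
theorem isDeRham_restrictedRationalTateRep_adicCompletion_of_potentiallyGoodOrdinary
    (W : WeierstrassCurve ℚ) [W.IsElliptic] {p : ℕ} [Fact p.Prime]
    (h : W.HasPotentiallyGoodOrdinaryReductionAtPrime p)
    {K' : Type} [Field K'] [NumberField K'] (w' : HeightOneSpectrum (𝓞 K')) (hw' : (p : 𝓞 K') ∈ w'.asIdeal)
    [CharZero (w'.adicCompletion K')] [Fact (¬ IsUnit (p : integerC (w'.adicCompletion K')))]
    [IsAdicComplete (Ideal.span {(p : integerC (w'.adicCompletion K'))}) (integerC (w'.adicCompletion K'))]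
    (hp' : valuation (w'.adicCompletion K') p < 1) [Algebra ℚ_[p] (w'.adicCompletion K')] :
    GaloisRep.IsDeRham (bdRPeriodRingData (F := w'.adicCompletion K') (p := p) hp')
      (restrictedRationalTateRep W (w'.adicCompletion K') p) := by
  -- the place `v = w' ∩ ℤ` of `ℚ` and the `p`-adic field `ℚ_v`
  set v := w'.under (𝓞 ℚ) with hv_def
  haveI : w'.asIdeal.LiesOver v.asIdeal := liesOver_under w'
  have hv : (p : 𝓞 ℚ) ∈ v.asIdeal := (natCast_mem_asIdeal_iff_of_liesOver v w' p).1 hw'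
  have hpv : valuation (v.adicCompletion ℚ) (p : v.adicCompletion ℚ) < 1 :=
    LocalField.valuation_adicCompletion_natCast_lt_one v p hv
  haveI : CharZero (v.adicCompletion ℚ) := LocalField.charZero_adicCompletion v
  haveI : Fact (¬ IsUnit ((p : ℕ) : integerC (v.adicCompletion ℚ))) := ⟨not_isUnit_natCast_integerC hpv⟩
  haveI : IsAdicComplete (Ideal.span {((p : ℕ) : integerC (v.adicCompletion ℚ))}) (integerC (v.adicCompletion ℚ)) :=
    isAdicComplete_integerC_natCast hpv
  letI : Algebra ℚ_[p] (v.adicCompletion ℚ) := LocalField.padicAlgebra (v.adicCompletion ℚ) p hpv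
  letI : Algebra (v.adicCompletion ℚ) (w'.adicCompletion K') := (adicCompletionOfLiesOver ℚ K' v w').toAlgebra
  haveI : IsScalarTower ℚ (v.adicCompletion ℚ) (w'.adicCompletion K') :=
    IsScalarTower.of_algebraMap_eq fun x => by
      rw [eq_ratCast (algebraMap ℚ (w'.adicCompletion K')) x, eq_ratCast (algebraMap ℚ (v.adicCompletion ℚ)) x,
        map_ratCast]
  have h0 := isDeRham_restrictedRationalTateRep_adicCompletion_rat_of_potentiallyGoodOrdinary W h v hv hpv
  exact isDeRham_restrictedRationalTateRep_of_tower W (continuous_adicCompletionOfLiesOver ℚ K' v w') hpv hp' h0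

/-- **CM curves: `V_pE|_{Γ_{K'_{w'}}}` is de Rham at every place `w' ∣ p` of every number field, for every odd prime `p`
SPLIT in the CM field** — Deuring's ordinary half (tree theorem
`hasPotentiallyGoodOrdinaryReductionAtPrime_of_hasCM_of_cmSplit'`: potentially good ORDINARY reduction at such `p`) fed to
the potentially-good-ordinary sector. (At inert/ramified `p` the reduction is supersingular — not covered here.)
[cite: Lang1987, Ch. 13 §4 Thm. 12] [cite: BrinonConrad2009, Prop. 6.3.8] [cite: Kato1993LNM1553, Ch. II Prop. 1.2.3] -/
theorem isDeRham_restrictedRationalTateRep_adicCompletion_of_hasCM_of_cmSplit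
    (E : WeierstrassCurve ℚ) [E.IsElliptic] (hCM : E.HasCM) {p : ℕ} [Fact p.Prime] (hp2 : p ≠ 2)
    (hsplit : Literature.NumberTheory.EllipticCurves.Rank1Residual.CMSplit E p)
    {K' : Type} [Field K'] [NumberField K'] (w' : HeightOneSpectrum (𝓞 K')) (hw' : (p : 𝓞 K') ∈ w'.asIdeal)
    [CharZero (w'.adicCompletion K')] [Fact (¬ IsUnit (p : integerC (w'.adicCompletion K')))]
    [IsAdicComplete (Ideal.span {(p : integerC (w'.adicCompletion K'))}) (integerC (w'.adicCompletion K'))]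
    (hp' : valuation (w'.adicCompletion K') p < 1) [Algebra ℚ_[p] (w'.adicCompletion K')] :
    GaloisRep.IsDeRham (bdRPeriodRingData (F := w'.adicCompletion K') (p := p) hp')
      (restrictedRationalTateRep E (w'.adicCompletion K') p) :=
  isDeRham_restrictedRationalTateRep_adicCompletion_of_potentiallyGoodOrdinary E
    (hasPotentiallyGoodOrdinaryReductionAtPrime_of_hasCM_of_cmSplit' E hCM Fact.out hp2 hsplit) w' hw' hp'

end Literature.NumberTheory.PAdicHodge

end
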